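import Literature.Probability.RandomPlanarGeometry.SAWTriangularEndpointRatioRate
import Literature.Probability.RandomPlanarGeometry.SAWTriangularPolygonInsertion
import HarnessLib

/-!
# `c_{N+1}(0,x)/c_N(0,x) → μ(𝕋)` with Kesten's mixed rate, for every `x ≠ 0` — unconditional

Topic `Literature/Probability/RandomPlanarGeometry` (lane «pcv-sawmu», item «TRI-ENDPOINT-RATIO(-RATE)», the last file:
the polygon insertion `PolygonInsertion.triEndpointIns` of `SAWTriangularPolygonInsertion.lean` (a-p2) discharges the only
hypothesis of `tendsto_card_triSLx_ratio_of_ins` / `triEndpointRatioRateMixed_of_ins`).  Source: N. Madras, G. Slade,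
*The Self-Avoiding Walk* (1993), Theorem 7.3.4(b) (p. 248) and §7.5 eq. (7.5.2) (p. 255), printed for `ℤ^d` (two steps,
parity of `‖x‖₁`); here the triangular lattice, ONE step, every `x ≠ 0`.
-/

noncomputable section

open Filter Topology Finset Literature.Probability.LatticeModels Literature.Probability.Percolation SimpleGraph

namespace Literature.Probability.RandomPlanarGeometry.SAW

/-- **Madras–Slade Theorem 7.3.4(b) on the triangular lattice, one step, unconditional**: for every `x ≠ 0`,
`c_{N+1}(0,x)/c_N(0,x) → μ(𝕋)`. [cite: MadrasSlade1993, Theorem 7.3.4(b) (p. 248)] -/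
theorem tendsto_card_triSLx_ratio (x : Site 2) (hx : x ≠ 0) :
    Tendsto (fun N : ℕ => (#(triSLx (N + 1) x) : ℝ) / #(triSLx N x)) atTop (𝓝 (Real.exp logMuTri)) :=
  tendsto_card_triSLx_ratio_of_ins x hx (PolygonInsertion.triEndpointIns x)

/-- **Kesten's mixed rate for `c_N(0,x)` on `𝕋`, one step, unconditional**: for every `x ≠ 0` there are `K, N₀` with
`−K N^{-1/3} ≤ c_{N+1}(0,x)/c_N(0,x) − μ(𝕋) ≤ K N^{-1/4}` for `N ≥ N₀`.
[cite: MadrasSlade1993, §7.5 eq. (7.5.2) (p. 255)] [cite: Kesten1963SAW, Theorem 2] -/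
theorem card_triSLx_ratio_rate (x : Site 2) (hx : x ≠ 0) :
    ∃ K : ℝ, ∃ N₀ : ℕ, ∀ N : ℕ, N₀ ≤ N →
      -(K * (N : ℝ) ^ (-(1 : ℝ) / 3)) ≤ (#(triSLx (N + 1) x) : ℝ) / #(triSLx N x) - Real.exp logMuTri ∧
        (#(triSLx (N + 1) x) : ℝ) / #(triSLx N x) - Real.exp logMuTri ≤ K * (N : ℝ) ^ (-(1 : ℝ) / 4) :=
  triEndpointRatioRateMixed_of_ins x hx (PolygonInsertion.triEndpointIns x)

/-- The lower envelope `e^{−c√N} μ(𝕋)^N ≤ c_N(0,x)` (`N ≥ N₁`), unconditional — the quantitative Corollary 3.2.6 on `𝕋`.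
[cite: MadrasSlade1993, Corollary 3.2.6 (p. 67)] -/
theorem triEndpointLo (x : Site 2) (hx : x ≠ 0) :
    ∃ c : ℝ, 0 ≤ c ∧ ∃ N₁ : ℕ, ∀ N : ℕ, N₁ ≤ N →
      Real.exp (-(c * Real.sqrt N)) * Real.exp logMuTri ^ N ≤ #(triSLx N x) :=
  triEndpointLo_of_ins x hx (PolygonInsertion.triEndpointIns x)

end Literature.Probability.RandomPlanarGeometry.SAW
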